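import Mathlib
import HarnessLib
import HarnessLib.Audit
import Summits.AnomalousDissipation.Statement
import Literature.Analysis.FluidPDE.StokesTorus
import Literature.Analysis.FluidPDE.StokesTorusProofs
import Literature.Analysis.FluidPDE.StatisticalSolution
import Summits.AnomalousDissipation.AnomalousDissipation.Theorems.TaylorCertificatesSteadyStatesLoudBoundedStubGpAdmissible
import HarnessLib.Audit.Status.Attr

/-!
Route: StirringSphere

DORMANT since 2026-08-25T11:42:58Z (reconciler: no traction for 7.7 d (last activity item-evidence-added at 2026-08-17T19:13:38Z); parked, not closed — `ledger route dormant route-AnomalousDissipation-StirringSphere --off` to reactivate) — unstaffed, not closed; items shared with open routes are served there. `ledger route dormant <id> --off` reactivates.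

# Route StirringSphere — you cannot comb the stirring sphere — hairy-ball alignment of mean flows on
a 2-sphere of steady forces

Fix the explicit 2-SPHERE OF STIRRINGS f_c = c₀b₀ + c₁b₁ + c₂b₂, ‖c‖ = 1 in ℝ³, with b₀ = f_GP =
sin(2πx₃)e₁ + sin(2πx₁)e₂ + sin(2πx₂)e₃ (the
Galloway–Proctor force of FrustratedForces / VirtualDissipation / EnsembleRigidity, byte-identical),
b₁ = cos(2πx₂)e₁ + cos(2πx₃)e₂ + cos(2πx₁)e₃
(anti-cyclic cosine partner) and b₂ = sin2π(x₂+x₃)e₁ + sin2π(x₃+x₁)e₂ + sin2π(x₁+x₂)e₃ (shell |k|² =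
2); every f_c is a smooth divergence-free mean-zero
trigonometric polynomial with ‖f_c‖₂² = 3/2. It suffices to show X = SphereEnsembleZerothLaw: SOME
force on this sphere obeys the ensemble zeroth law
(Literature.Analysis.FluidPDE.EnsembleZerothLawAt (f_c): Foias–Prodi stationary statistical
solutions at ν_j → 0 with bounded mean energy and ensemble
dissipation ≥ ε > 0), which reaches the summit through the realisation crux of route Ensemble
(stmt-AnomalousDissipation-0215, re-asked verbatim). X is reached
by a TOPOLOGICAL ALIGNMENT: the mean-flow response vector y(μ) = (∫(u,b_i)dμ)_i ∈ ℝ³ of a stationary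
statistics μ of NS_ν(f_c) has c·y(μ) = ensemble
injection ≥ 0, so c ↦ {y(μ)} is a set-valued field on S² with values in the closed hemisphere over
c; if the bounded statistics never SCREEN the sphere
(|y| ≥ m₀ uniformly in ν, crux NoScreening) the hairy-ball theorem forces, at every small ν, a point
c_ν where y ∥ c_ν, i.e. an exact, loud, bounded force
(the conclusion of HairyBallAlignment — formerly the support node AlignedLoudForces: injection = |y|
≥ m₀); SphereTransfer carries this ν-dependent
alignment to one force of the sphere. (Rev 4, cone repair: X is stated with EnsembleZerothLawAt
UNFOLDED — definitionally the same proposition, Iff.rfl —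
so that the route file imports only StokesTorus(Proofs), StatisticalSolution and the landed
GpAdmissible lemmas, keeping the conjecture module
StatisticalSolutions and TorusForceBookkeeping → CheskidovTotalDissipation out of its import cone.)
Lean: `∀ b : Fin 3 → UnitAddTorus (Fin 3) → EuclideanSpace ℝ (Fin 3), b = ![(fun x : UnitAddTorus
(Fin 3) => (Literature.Analysis.FluidPDE.Torus.stokesMode (Pi.single (2 : Fin 3) (1 : ℤ))
(EuclideanSpace.single (0 : Fin 3) (1 : ℝ)) false x + Literature.Analysis.FluidPDE.Torus.stokesMode
(Pi.single (0 : Fin 3) (1 : ℤ)) (EuclideanSpace.single (1 : Fin 3) (1 : ℝ)) false x +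
Literature.Analysis.FluidPDE.Torus.stokesMode (Pi.single (1 : Fin 3) (1 : ℤ)) (EuclideanSpace.single
(2 : Fin 3) (1 : ℝ)) false x : EuclideanSpace ℝ (Fin 3))), (fun x : UnitAddTorus (Fin 3) =>
(Literature.Analysis.FluidPDE.Torus.stokesMode (Pi.single (1 : Fin 3) (1 : ℤ))
(EuclideanSpace.single (0 : Fin 3) (1 : ℝ)) true x + Literature.Analysis.FluidPDE.Torus.stokesMode
(Pi.single (2 : Fin 3) (1 : ℤ)) (EuclideanSpace.single (1 : Fin 3) (1 : ℝ)) true x +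
Literature.Analysis.FluidPDE.Torus.stokesMode (Pi.single (0 : Fin 3) (1 : ℤ)) (EuclideanSpace.single
(2 : Fin 3) (1 : ℝ)) true x : EuclideanSpace ℝ (Fin 3))), (fun x : UnitAddTorus (Fin 3) =>
(Literature.Analysis.FluidPDE.Torus.stokesMode ![(0 : ℤ), 1, 1] (EuclideanSpace.single (0 : Fin 3)
(1 : ℝ)) false x + Literature.Analysis.FluidPDE.Torus.stokesMode ![(1 : ℤ), 0, 1]
(EuclideanSpace.single (1 : Fin 3) (1 : ℝ)) false x + Literature.Analysis.FluidPDE.Torus.stokesMode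
![(1 : ℤ), 1, 0] (EuclideanSpace.single (2 : Fin 3) (1 : ℝ)) false x : EuclideanSpace ℝ (Fin 3)))] →
∃ c : EuclideanSpace ℝ (Fin 3), ‖c‖ = 1 ∧ ∃ (ν : ℕ → ℝ) (μ : ℕ → MeasureTheory.Measure
(Literature.Analysis.FunctionSpaces.Torus.energySpace (Fin 3))), (∀ j, 0 < ν j) ∧ Filter.Tendsto ν
Filter.atTop (nhds 0) ∧ (∀ j, Literature.Analysis.FluidPDE.Torus.IsStationaryStatisticalSolution (ν
j) (fun x : UnitAddTorus (Fin 3) => ∑ i : Fin 3, c i • b i x) (μ j)) ∧ (∀ j,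
MeasureTheory.Integrable (fun u : Literature.Analysis.FunctionSpaces.Torus.energySpace (Fin 3) =>
‖u‖ ^ 2) (μ j)) ∧ (∃ E : ℝ, ∀ j, Literature.Analysis.FluidPDE.Torus.ensembleEnergy (μ j) ≤ E) ∧ ∃ ε
: ℝ, 0 < ε ∧ ∀ j, ε ≤ Literature.Analysis.FluidPDE.Torus.ensembleDissipation (ν j) (μ j)`

## Assembly
Pure logic, certified (glue.lean = theorem `closes`, Sketch.lean rc 0, no sorry): HairyBallAlignment
turns NoScreening and BoundedSphereStatistics into
aligned loud forces at every small ν; SphereTransfer turns that into SphereEnsembleZerothLaw, i.e. a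
unit c* with (unfolded) EnsembleZerothLawAt (f_{c*}); unpack its
family (ν_j, μ_j, E', ε);
SphereForcesAdmissible gives IsSmooth / IsDivFree / HasZeroMean of f_{c*}, so EnsembleRealization at
(f_{c*}, E', ε) yields one j-independent M and, for every j, a
global Leray–Hopf trajectory with meanEnergy ≤ M and meanDissipation ≥ ε/2 — verbatim the clauses of
Literature.Turb.ZerothLaw = AnomalousDissipation (same term as
route Ensemble's `closes`). The deciding theorem uses every crux; the homogeneity of
divergence-freeness / zero mean under scalars is derived inline from
Torus.divergence_eq_trace_fderiv, Torus.fderiv_const_smul and integral_smul (rev 4). The item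
`Assembly` (cruxes → SphereForcesAdmissible → AnomalousDissipation)
is the optional D-0016 assembly decl and follows from `closes` by dropping its last hypothesis.

Rationale: WHY THIS LINE. Imported from algebraic topology: the Poincaré–Hopf / hairy-ball theorem (Milnor1978;
IN TREE and proved,
Literature.Topology.Euclidean.HairyBall.exists_eq_zero_of_tangent), applied not to the fluid but to
the SPHERE OF FORCES: injection ∫(f_c,u)dμ = c·y(μ) is the RADIAL
component of the mean-flow response y and misalignment its TANGENTIAL component, so "some force is
loud" becomes "a tangent field on S² has a zero", which topology
gives for free once y cannot vanish (FMRTTurbulence2001 Ch. IV–V for the statistical-solution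
calculus; DoeringFoias2002 §2 for the budget ν∫‖∇u‖² ≤ ∫(f,u) ≤
‖f‖E^{1/2}). Every positive route on the ledger must prove a SIGN/FLOOR for its own fixed force
(Correlation's persistence, Ensemble #2, the certificate and rigidity
families); this line asks only a NON-VANISHING of the low-mode mean flow, uniformly over a 2-sphere
— a codimension-3 exclusion insensitive to how the turbulence
ROTATES its response — and lets χ(S²) = 2 supply the alignment; at fixed ν > 0 non-vanishing is
automatic (c·y = injection ≥ ν·enstrophy > 0), so the crux is purely
the ν-uniformity. What it does NOT do: the aligned force moves with ν (pinned zeros exist only at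
symmetric forces, where no-screening collapses to the floor; common
zeros at several ν are topologically unforced since e(TS² ⊕ TS²) = 0), so an inviscid transfer crux
of the BaireTransfer / FiniteIntersection species
(Cheskidov2023 §1.2 narrow class,
Literature.Barriers.AnomalousDissipation.ForceRobustNoAnomalyNarrow) is load-bearing and declared as
such; the negatives index
(GPEnergyCeiling, EnsembleCeilingBridge) is dodged because all energy clauses are EXISTENTIAL over
statistics on the mean-zero space H.

RANKED CRUXES. #0 SphereEnsembleZerothLaw (target) — some unit c gives a force f_c = Σ c_i b_i on
the explicit stirring sphere satisfying Literature.Analysis.FluidPDE.EnsembleZerothLawAt (f_c)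
(Foias–Prodi stationary statistical solutions along ν_j → 0, integrable and uniformly bounded mean
energy, ensemble dissipation ≥ ε > 0) — written out in full since rev 4 (the δ-unfolding of
EnsembleZerothLawAt, Iff.rfl with the rev-3 text; provers may still close it by `exact` from
EnsembleZerothLawAt lemmas), so that the conjecture module StatisticalSolutions is not imported by
the route file. (why it might fail: every force on this particular sphere may be quiet in the
inviscid limit (the sphere is 2-dimensional inside a 12+-dimensional low-mode space), or
bounded-energy statistics may not exist for some of them.) [FMRTTurbulence2001, DoeringFoias2002,
Frisch1995, arXiv:2207.06301]
#2 NoScreening (crux) — ν-UNIFORM NON-SCREENING OF THE SPHERE. For every energy level E there are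
ν₀, m₀ > 0 such that for every unit c, every ν ∈ (0,ν₀) and every Foias–Prodi stationary statistical
solution μ of NS_ν(f_c) with integrable energy ≤ E, the mean-flow response vector y(μ) =
(∫(u,b_i)dμ)_{i<3} has |y(μ)| ≥ m₀ — the turbulence may rotate the mean flow away from the force but
cannot erase its projection on span(b₀,b₁,b₂). True at each fixed ν (c·y = injection > 0); the
content is uniformity as ν → 0. [difficulty: open-problem] (why it might fail: an inviscid-limit
statistics of some f_c may carry its mean flow entirely OUTSIDE span(b₀,b₁,b₂) (e.g. in the other
nine shell-1 modes or a condensate), with Reynolds stresses alone balancing f_c on V — perfect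
low-mode screening as ν → 0.) [FMRTTurbulence2001, DoeringFoias2002, MusacchioBoffetta2014,
KanedaEtAl2003, Cheskidov2023]
#3 BoundedSphereStatistics (crux) — BOUNDED STATISTICS ON THE WHOLE SPHERE. There are E, ν₀ > 0 such
that every unit c and every ν ∈ (0,ν₀) admit a Foias–Prodi stationary statistical solution of
NS_ν(f_c) with integrable mean energy ≤ E (the energy half of the zeroth law, existential over
statistics on the mean-zero space H, but uniform over the 2-sphere of forces). [difficulty:
open-problem] (why it might fail: some direction of the sphere may be laminar-prone: all its
stationary statistics could follow the Stokes scaling ∫|u|²dμ ~ ν⁻² (runaway), as for gravest-mode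
planar forcing; no ν-uniform energy bound is known for ANY fixed 3-D force.) [FMRTTurbulence2001,
ConstantinTarfuleaVicol2013, DoeringFoias2002,
Literature.Barriers.AnomalousDissipation.Marchioro1986_globalAttraction]
#4 SphereTransfer (crux) — TRANSFER TO ONE FORCE. If for every small ν some unit c_ν carries a
bounded stationary statistics of NS_ν(f_{c_ν}) with injection ≥ m₀ (AlignedLoudForces), then some
fixed unit c* satisfies EnsembleZerothLawAt (f_{c*}): loudness of a sequence of forces converging
INSIDE THE FIXED 3-DIMENSIONAL FAMILY (hence in C^∞) passes to a single force, with ensemble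
dissipation (not only injection) bounded below. [deps: NoScreening, BoundedSphereStatistics]
[difficulty: open-problem] (why it might fail: the aligned point may wander on S² so that every
fixed force is eventually quiet (inviscid statistics need not be upper-hemicontinuous in the force),
and ensemble injection ≥ m₀ need not give ensemble DISSIPATION ≥ ε (3-D leakage, FMRT IV (1.31) is
an inequality).) [Cheskidov2023,
Literature.Barriers.AnomalousDissipation.ForceRobustNoAnomalyNarrow, FMRTTurbulence2001,
arXiv:2207.06301]
#5 EnsembleRealization (crux) — REALISATION (verbatim route Ensemble's crux
stmt-AnomalousDissipation-0215, shared): for a smooth divergence-free mean-zero force, every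
stationary statistical solution with mean energy ≤ E and ensemble dissipation ≥ ε is shadowed by one
global Leray–Hopf trajectory with limsup-mean energy ≤ M(f,E,ε) and limsup-mean dissipation ≥ ε/2.
[difficulty: L] (why it might fail: a diffuse Foias–Prodi μ in 3-D need not be a marginal of a
shift-invariant law on Leray–Hopf paths (VF ⊂ FP; lift proved for time-average measures only,
FoiasRosaTemam2019 Thm 5.5); an unshadowed spurious μ breaks it.) [FoiasRosaTemam2019,
FMRTTurbulence2001, FoiasPadova1972]
(former #9 AlignedLoudForces, support, DROPPED at rev 2: its text is now the conclusion of
HairyBallAlignment and the hypothesis of SphereTransfer; kept here for reading the thesis) —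
intermediate node (= HairyBallAlignment applied to NoScreening and BoundedSphereStatistics; the
sphere zeroth law with ν-DEPENDENT forces confined to the fixed 3-dimensional family): there are E,
ν₀, m₀ > 0 such that every ν ∈ (0,ν₀) has a unit c and a stationary statistical solution μ of
NS_ν(f_c) with integrable energy ≤ E and ensemble injection ∫(f_c,u)dμ ≥ m₀. Not expected to be
proved directly. [difficulty: open-problem] [FMRTTurbulence2001, Milnor1978]
#6 HairyBallAlignment (crux since the rev-3 retriage, was support #9; a hypothesis of `closes`) —
THE TOPOLOGICAL STEP (provable): NoScreening → BoundedSphereStatistics → (aligned loud forces, the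
former AlignedLoudForces body). At fixed ν ∈ (0,ν₀): (i) K(c) := {y(μ) : μ stationary statistical
solution of NS_ν(f_c), integrable energy ≤ E} ⊂ ℝ³ is nonempty (Bounded), convex (the class is
convex, y linear) and has closed graph in c (all such μ are carried by the ball ‖u‖ ≤ ‖f_c‖₂/(4π²ν),
in-tree IsStationaryStatisticalSolution.ae_norm_le; mean enstrophy ≤ ‖f_c‖E^½/ν gives tightness in
the NORM topology of H by Rellich, and the generator identity, the shell energy inequalities and
∫‖u‖² pass to weak limits of measures); (ii) c·y = ∫(f_c,u)dμ ≥ ν·enstrophy ≥ 0 (FMRT IV (1.31) with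
e₁ = 0, e₂ = ∞); (iii) if 0 were never in the tangential part {y − (c·y)c}, upper hemicontinuity and
a partition of unity give a continuous nowhere-zero tangent field on S² (Cellina-type selection),
contradicting Literature.Topology.Euclidean.HairyBall.exists_eq_zero_of_tangent (dim ℝ³ odd); so
some c has y(μ) = (c·y)c with |y| ≥ m₀ (NoScreening), i.e. injection = |y| ≥ m₀. [difficulty: L]
[Milnor1978, doi:10.1007/bf02410784, FMRTTurbulence2001,
Literature.Topology.Euclidean.HairyBall.exists_eq_zero_of_tangent]
#9 SphereForcesAdmissible (support) — every f_c = Σ c_i b_i is smooth, divergence-free and mean-zero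
(finite sums of Stokes modes with k ≠ 0 and k·a = 0: isSmooth_stokesMode, isDivFree_stokesMode,
hasZeroMean_stokesMode, closure under + and scalar •). [difficulty: provable-now]
[Literature.Analysis.FluidPDE.Torus.isSmooth_stokesMode,
Literature.Analysis.FluidPDE.Torus.isDivFree_stokesMode,
Literature.Analysis.FluidPDE.Torus.hasZeroMean_stokesMode]

TWO-LAYER PLAN. HairyBallAlignment ⇐ ClosedGraphBoundedSSS (weak limits, at fixed ν, of bounded
stationary statistics of f_{c_n}, c_n → c, are bounded stationary statistics of f_c)
→ SetValuedHairyBall (u.h.c. compact-convex hemisphere-valued fields on S² have an aligned point) →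
HairyBallAlignment (k = 2). SphereTransfer ⇐ InviscidGraph
(exact-force inviscid limit sets of bounded statistics are upper-hemicontinuous on the sphere:
limits along f_{c_j} → f_{c*} are limits along f_{c*}) →
EnsembleNoLeakage (ensemble injection floor ⇒ ensemble dissipation floor for Foias–Prodi statistics
of a smooth force) → SphereTransfer (k = 2). NoScreening ⇐
per-arena statements (c near ±e₀: the GP arena shared with EnsembleRigidity / VirtualDissipation)
are NOT children — the sphere is indivisible for the topology.

KILL CRITERIA. A bounded inviscid-limit statistics of some f_c with mean flow ⊥ span(b₀,b₁,b₂)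
(¬NoScreening, e.g. from a symmetric construction or a converged DNS census showing
|y| → 0 along ν) closes `refuted:NoScreening` — pivot only by ENLARGING the odd-dimensional family V
(any odd dim works verbatim), filed as a new route, not a restate.
¬BoundedSphereStatistics at one direction (runaway statistics) ⇒ same: the sphere must be moved,
close `refuted:BoundedSphereStatistics`. A proof of
Literature.Barriers.AnomalousDissipation.ForceRobustNoAnomalyNarrow-type rigidity for steady
finite-dimensional perturbations refutes SphereTransfer's species ⇒ close
`refuted:SphereTransfer` (the lever then only decides the narrow force-robust class, a Literature
statement, not the summit). EnsembleRealization refuted ⇒ shared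
fate with route Ensemble: restate over time-average measures if the refutation is by a spurious
non-shadowed μ. EnsembleZerothLawAt proved for ANY force elsewhere
(Ensemble #2) moots cruxes 2–4; ZerothLawNeg (route Neg) proved kills the route.

NOT DECOMPOSED YET. The dimension and position of the force family (3 is minimal; any
odd-dimensional V ∋ f_GP works with the same glue — enlarging V weakens NoScreening per force
but asks Bounded of more forces); quantitative winding information (index +2 could localise the
aligned force near the laminar eigen-directions for moderate ν —
a continuation-in-ν picture deliberately not filed); the set-valued hairy-ball lemma and the
closed-graph lemma (layer-2 children of HairyBallAlignment); the
ensemble no-leakage half hidden in SphereTransfer; Galerkin-level variants (invariant measures of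
truncations, where injection = dissipation exactly) — a
sibling decomposition, not filed.

CHEAPEST FALSIFIER. (a) Lookup, done: is there ANY symmetry g of T³ with g·b_i = −b_i for all i and
g·f_c = f_c (which would force y = 0 for symmetrised statistics)? No: g·b_i = −b_i
∀i forces g·f_c = −f_c, and a statistics stationary for both f_c and −f_c contradicts the generator
identity tested on (u,f_c) (‖f_c‖² = 0) — exact screening by
symmetry is impossible on this sphere; at fixed ν > 0 every stationary statistics has c·y =
injection ≥ ν·enstrophy > 0. (b) Not run (beyond a lookup): a 32³–64³
pseudo-spectral census of ȳ(c) = long-time means of ((u,b_i))_i for ~20 points c ∈ S² at Re ≈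
200–800 (one batched kit job): |ȳ| bounded below and a visibly
non-degenerate winding of the tangential part would support NoScreening; |ȳ(c)| collapsing with Re
at some c kills it cheaply.

NUMBERS. ‖b_i‖₂² = 3/2, (b_i,b_j) = 0 (i ≠ j): disjoint Fourier supports — b₀:
(0,0,1),(1,0,0),(0,1,0) sine; b₁: same wavevectors, cosine, other polarisation;
b₂: (0,1,1),(1,0,1),(1,1,0) sine — so ‖f_c‖₂² = 3/2 on the sphere and f_c ≠ 0. Stokes eigenvalues
4π² (b₀,b₁), 8π² (b₂). Laminar regime (ν large): y = (A⁻¹f_c, b_i)/ν,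
aligned exactly iff c is an eigen-direction (c₂ = 0 or c = ±e₂): the tangent field's zero set at
large ν is the equator {c₂ = 0} ∪ poles {±e₂} (total index 2).
FMRT support bound: statistics of NS_ν(f_c) live in ‖u‖ ≤ ‖f_c‖₂/(4π²ν). Items at open: 9 (target,
assembly, 4 cruxes, 3 supports).
Items after rev 4: 7 (target; cruxes NoScreening 2, BoundedSphereStatistics 3, SphereTransfer 4,
EnsembleRealization 5 (shared stmt-AnomalousDissipation-0215),
HairyBallAlignment 6; support SphereForcesAdmissible) plus the optional Assembly decl (rank 1; it
follows from `closes` by discarding its SphereForcesAdmissible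
hypothesis — the gate keeps assembly items, so the glue.unused-crux advisory on it is accepted).
IMPORT CONE (rev-4 cone repair; planner census from the import headers of the cone's files — the
precomputed run/shared/views/cone/AnomalousDissipation
views named in the repair payload were absent on this hub): imports =
[Literature.Analysis.FluidPDE.StokesTorus, .StokesTorusProofs, .StatisticalSolution,
Summits.….Theorems.TaylorCertificatesSteadyStatesLoudBoundedStubGpAdmissible] on top of the
gate-mandated Summits.AnomalousDissipation.Statement. DROPPED:
Literature.Analysis.FluidPDE.TorusForceBookkeeping (used only by `closes`, for
Torus.isDivFree_const_smul / Torus.hasZeroMean_const_smul, now derived inline; it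
dragged in CheskidovTotalDissipation with the holds-free XL fact cheskidov_total_dissipation_family,
plus EulerReynolds, PassiveScalar(Proofs),
TorusSpaceTime(Fields), HeatKernel, TorusMollifier …);
Literature.Analysis.FluidPDE.StatisticalSolutions (imported only for the vocabulary
EnsembleZerothLawAt, now
unfolded in the target; it carries the registered open conjecture EnsembleZerothLaw, counted as an
XL unproved cone fact by the staffing screen);
Literature.Topology.Euclidean.HairyBall (+ BrouwerFixedPoint: the in-tree hairy-ball theorem is a
SOURCE of HairyBallAlignment, used by no decl of this file — its
prover's Theorems file imports it). Project modules in the import closure 51 → 34 (17 dropped, 0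
added); every item decl except the target is byte-identical to
rev 3, and the target is definitionally unchanged. Holds-free argument-free `def … : Prop` outside
the Statement's own closure: {cheskidov_total_dissipation_family,
EnsembleZerothLaw, LinearPMap.IsEssentiallySelfAdjoint.isSymmetric} →
{LinearPMap.IsEssentiallySelfAdjoint.isSymmetric} (UnboundedOperators/SymmetricPMap.lean,
cite ReedSimonI1980 §VIII.2), which enters with Literature.Analysis.FluidPDE.StokesTorus = the
module DEFINING Torus.stokesMode, i.e. with f_GP itself, is shared
verbatim by FrustratedForces / VirtualDissipation / EnsembleRigidity / TaylorCertificates, and is a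
hypothesis of no item (if the screen counts it, it is one
provefact seat for all f_GP routes, not route-attributable debt). needs-fact: NONE. Gate decl-cone:
0 unproved constants before and after.

DEFINITION REQUESTS. None: stokesMode, IsStationaryStatisticalSolution, pairing, ensembleEnergy,
ensembleDissipation, EnsembleZerothLawAt, IsGlobalLerayHopf, meanEnergy,
meanDissipation all exist (lean search); the hairy-ball theorem is the in-tree theorem
Literature.Topology.Euclidean.HairyBall.exists_eq_zero_of_tangent.
Cite wanted (optional, for HairyBallAlignment's prover): Cellina 1969, approximate selections of
u.h.c. convex-valued maps (doi:10.1007/bf02410784).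

Novelty: Searches (2026-08-16): the sub's 45 Theses + 134 idea cards grep'd for
hairy|Poincaré–Hopf|Brouwer|Kakutani|Borsuk|Lefschetz|equivariant degree|antipodal
(hits: Brouwer for Galerkin steady existence in MirrorVariety/AveragedCascade, Ize–Vignoli
equivariant degree for Hopf branches in HopfSnake, "antipodal" jets in
LandauJetArena — none acts on a sphere of FORCES); `ledger idea list --problem AnomalousDissipation
--status all` (134 cards; nearest: symmetry-frustrates-refusal
(equivariant Galerkin alternative + random-force census, variant), novikov-trace-turbulent-mobility
(Gaussian force ensemble, variant), baire-transfer /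
nu-independence-finite-intersection (category / compactness on force space)); `lit frontier
AnomalousDissipation --since 2024` (60 rows: non-uniqueness, passive
scalars, codim-1 dissipation — nothing on force-space topology); `lit search --hybrid "hairy ball
theorem tangent vector field sphere fluid forcing mean flow"` (8 books:
topology texts, Majda–Bertozzi p.56 — unrelated); `lit search --hybrid "Poincare-Hopf index theorem
Navier-Stokes body force existence turbulent"` (8: FMRT, Kuksin–Shirikyan,
Doering–Gibbon — no such use); `lit galaxy search "hairy ball theorem" --star all` (33 rows:
PPAD-completeness, geometry notes, pose priors — none in fluids);
`lit galaxy search "zeroth law of turbulence" --star all` (10); Eyink2024 JFM Perspectives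
(arXiv:2404.10084) pp. 6–8, 27, 29 READ (status of the zeroth law, Iyer–Drivas–Eyink–Sreenivasan
2024 weak-anoma  [refs: 2404.10084, Milnor1978, FMRTTurbulence2001]

Barriers (technique_class: force-sphere-degree, statistical-solutions): - technique_class: force-sphere-degree, statistical-solutions
- Literature.Barriers.AnomalousDissipation.Cheskidov2023_thm13_not_forceRobustNoAnomaly: a no-go for
NO-anomaly proofs; this line is positive-side and uses the fixed force exactly (generator identity
with the exact f_c) — but its hairy-ball output is a sequence of ν-dependent steady forces
converging in a FIXED 3-dimensional space, i.e. precisely a candidate witness against the NARROW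
residual ForceRobustNoAnomalyNarrow; conceded: SphereTransfer is of that open species and nothing
here evades it — the bet is that C^∞-convergent steady low-mode perturbations are statistically
continuous in the inviscid limit.
- Literature.Barriers.AnomalousDissipation.Marchioro1986_globalAttraction: gravest-shell PLANAR
forcing is laminar with runaway energy; every f_c is a genuinely three-dimensional GP-type pattern
on H (mean-zero, so no Galilean drift states), outside the pincer class; conceded in
BoundedSphereStatistics' why-might-fail that a laminar-prone direction of the sphere would kill crux
3.
- Literature.Barriers.AnomalousDissipation.AlexakisDoering2006_energyDissipationBound: 2-D forcing
gives ε ≲ Re^{-1/2}; no f_c is x_i-invariant (each has all three coordinates in its phases), so the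
planar class is not an invariant subspace of NS(f_c); if statistics two-dimensionalise anyway,
NoScreening may still hold while SphereTransfer's dissipation clause fails — recorded, not evaded.
- Literature.Barriers.AnomalousDissipation.Bu

History (route lifecycle, newest last):
- 2026-08-16T22:40:03Z · rev 1: restated HairyBallAlignment (stmt-AnomalousDissipation-17148) — restate HairyBallAlignment self-contained (its conclusion = the former AlignedLoudForces body, verbatim) ahead of the crux-only closes repair (planner-plan-novel-AnomalousDissipation-Anomalo-efd7bd3a-v2-)
- 2026-08-16T22:40:24Z · rev 2: dropped AlignedLoudForces — crux-only deciding theorem (glue.non-crux-hypothesis repair, step B): drop the intermediate support AlignedLoudForces (its text now lives inside HairyBallAlignm (planner-plan-novel-AnomalousDissipation-Anomalo-efd7bd3a-v2-)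
- 2026-08-16T22:55:00Z · rev 4: restated SphereEnsembleZerothLaw (stmt-AnomalousDissipation-17143) — cone repair (route-repair seat; payload: 5 unproved import-cone facts, EnsembleZerothLaw + cheskidov_total_dissipation_family first): imports := [StokesTorus, S (planner-rrepair-AnomalousDissipation-StirringS-6d60ce93-0)
- 2026-08-25T11:42:58Z · DORMANT — reconciler: no traction for 7.7 d (last activity item-evidence-added at 2026-08-17T19:13:38Z); parked, not closed — `ledger route dormant route-AnomalousDissipa (operator:999:951502)

sub-problem: AnomalousDissipation · status: dormant · opened planner-plan-novel-AnomalousDissipation-Anomalo-efd7bd3a-v2-g12-0 2026-08-16T22:34:31Z · rev 4 · ledger route-AnomalousDissipation-StirringSphere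
GENERATED by the gate from the ledger (D-0016/17). Provers cite these decls: `theorem foo : Summit.AnomalousDissipation.AnomalousDissipation.Theses.StirringSphere.<Decl> := …` in Summits/AnomalousDissipation/AnomalousDissipation/Theorems/<Name>.lean.
-/

namespace Summit.AnomalousDissipation.AnomalousDissipation.Theses.StirringSphere

open scoped BigOperators Topology Manifold Classical MeasureTheory ProbabilityTheory Matrix InnerProductSpace ComplexConjugate ContinuousMap
open Filter Set Function TopologicalSpace MeasureTheory

attribute [summit_statement] _root_.AnomalousDissipation

open Literature.Turb

-- earlier SphereEnsembleZerothLaw (stmt-AnomalousDissipation-17143, replaced 2026-08-16T22:55:00Z -> stmt-AnomalousDissipation-17221): retired by None — ∀ b : Fin 3 → UnitAddTorus (Fin 3) → EuclideanSpace ℝ (Fin 3), b = ![(fun x : UnitAddTorus (Fin 3) => (Literature.Analysis.FluidPDE.Torus.stokesMode (Pi.single (2 : Fin 3) (1 : ℤ)) (EuclideanSpace.single (0 : Fin 3) (1 : ℝ)) false x + Literature.Ana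
/-- item stmt-AnomalousDissipation-17221 · target · rank 0 · open · by planner
why it might fail: every force on this particular sphere may be quiet in the inviscid limit (the sphere is 2-dimensional inside a 12+-dimensional low-mode space), or bounded-energy statistics may not exist for some of them.
sources: FMRTTurbulence2001, DoeringFoias2002, Frisch1995, arXiv:2207.06301
[target] some unit c gives a force f_c = Σ c_i b_i on the explicit stirring sphere obeying the
ensemble zeroth law: viscosities ν_j > 0 with ν_j → 0 and Foias–Prodi stationary statistical
solutions μ_j of NS_{ν_j}(f_c) with integrable, uniformly bounded mean energy (ensembleEnergy μ_j ≤
E) and ensemble dissipation ensembleDissipation ν_j μ_j ≥ ε > 0 for all j — verbatim the δ-unfolding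
of Literature.Analysis.FluidPDE.EnsembleZerothLawAt (f_c) (rev 4 cone repair: unfolded so that the
route file no longer imports the conjecture module StatisticalSolutions; Iff.rfl with the rev-3
statement, so provers may still conclude by `exact` from EnsembleZerothLawAt lemmas). -/
@[route_item "route-AnomalousDissipation-StirringSphere"]
def SphereEnsembleZerothLaw : Prop :=
  ∀ b : Fin 3 → UnitAddTorus (Fin 3) → EuclideanSpace ℝ (Fin 3), b = ![(fun x : UnitAddTorus (Fin 3) => (Literature.Analysis.FluidPDE.Torus.stokesMode (Pi.single (2 : Fin 3) (1 : ℤ)) (EuclideanSpace.single (0 : Fin 3) (1 : ℝ)) false x + Literature.Analysis.FluidPDE.Torus.stokesMode (Pi.single (0 : Fin 3) (1 : ℤ)) (EuclideanSpace.single (1 : Fin 3) (1 : ℝ)) false x + Literature.Analysis.FluidPDE.Torus.stokesMode (Pi.single (1 : Fin 3) (1 : ℤ)) (EuclideanSpace.single (2 : Fin 3) (1 : ℝ)) false x : EuclideanSpace ℝ (Fin 3))), (fun x : UnitAddTorus (Fin 3) => (Literature.Analysis.FluidPDE.Torus.stokesMode (Pi.single (1 : Fin 3) (1 : ℤ)) (EuclideanSpace.single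 (0 : Fin 3) (1 : ℝ)) true x + Literature.Analysis.FluidPDE.Torus.stokesMode (Pi.single (2 : Fin 3) (1 : ℤ)) (EuclideanSpace.single (1 : Fin 3) (1 : ℝ)) true x + Literature.Analysis.FluidPDE.Torus.stokesMode (Pi.single (0 : Fin 3) (1 : ℤ)) (EuclideanSpace.single (2 : Fin 3) (1 : ℝ)) true x : EuclideanSpace ℝ (Fin 3))), (fun x : UnitAddTorus (Fin 3) => (Literature.Analysis.FluidPDE.Torus.stokesMode ![(0 : ℤ), 1, 1] (EuclideanSpace.single (0 : Fin 3) (1 : ℝ)) false x + Literature.Analysis.FluidPDE.Torus.stokesMode ![(1 : ℤ), 0, 1] (EuclideanSpace.single (1 : Fin 3) (1 : ℝ)) false x + Literature.Analysis.FluidPDE.Torus.stokesMode ![(1 : ℤ), 1, 0] (EuclideanSpace.single (2 : Fin 3) (1 : ℝ)) false x : EuclideanSpace ℝ (Fin 3)))] → ∃ c : EuclideanSpace ℝ (Fin 3), ‖c‖ = 1 ∧ ∃ (ν : ℕ → ℝ) (μ : ℕ → MeasureTheory.Measure (Literature.Analysis.FunctionSpaces.Torus.energySpace (Fin 3))), (∀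 j, 0 < ν j) ∧ Filter.Tendsto ν Filter.atTop (nhds 0) ∧ (∀ j, Literature.Analysis.FluidPDE.Torus.IsStationaryStatisticalSolution (ν j) (fun x : UnitAddTorus (Fin 3) => ∑ i : Fin 3, c i • b i x) (μ j)) ∧ (∀ j, MeasureTheory.Integrable (fun u : Literature.Analysis.FunctionSpaces.Torus.energySpace (Fin 3) => ‖u‖ ^ 2) (μ j)) ∧ (∃ E : ℝ, ∀ j, Literature.Analysis.FluidPDE.Torus.ensembleEnergy (μ j) ≤ E) ∧ ∃ ε : ℝ, 0 < ε ∧ ∀ j, ε ≤ Literature.Analysis.FluidPDE.Torus.ensembleDissipation (ν j) (μ j)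

/-- item stmt-AnomalousDissipation-17144 · crux · rank 2 · open · by planner
why it might fail: an inviscid-limit statistics of some f_c may carry its mean flow entirely OUTSIDE span(b₀,b₁,b₂) (e.g. in the other nine shell-1 modes or a condensate), with Reynolds stresses alone balancing f_c on V — perfect low-mode screening as ν → 0.
sources: FMRTTurbulence2001, DoeringFoias2002, MusacchioBoffetta2014, KanedaEtAl2003, Cheskidov2023
[crux] ν-UNIFORM NON-SCREENING OF THE SPHERE. For every energy level E there are ν₀, m₀ > 0 such
that for every unit c, every ν ∈ (0,ν₀) and every Foias–Prodi stationary statistical solution μ of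
NS_ν(f_c) with integrable energy ≤ E, the mean-flow response vector y(μ) = (∫(u,b_i)dμ)_{i<3} has
|y(μ)| ≥ m₀ — the turbulence may rotate the mean flow away from the force but cannot erase its
projection on span(b₀,b₁,b₂). True at each fixed ν (c·y = injection > 0); the content is uniformity
as ν → 0. [difficulty: open-problem] -/
@[route_item "route-AnomalousDissipation-StirringSphere", crux]
def NoScreening : Prop :=
  ∀ b : Fin 3 → UnitAddTorus (Fin 3) → EuclideanSpace ℝ (Fin 3), b = ![(fun x : UnitAddTorus (Fin 3) => (Literature.Analysis.FluidPDE.Torus.stokesMode (Pi.single (2 : Fin 3) (1 : ℤ)) (EuclideanSpace.single (0 : Fin 3) (1 : ℝ)) false x + Literature.Analysis.FluidPDE.Torus.stokesMode (Pi.single (0 : Fin 3) (1 : ℤ)) (EuclideanSpace.single (1 : Fin 3) (1 : ℝ)) false x + Literature.Analysis.FluidPDE.Torus.stokesMode (Pi.single (1 : Fin 3) (1 : ℤ)) (EuclideanSpace.single (2 : Fin 3) (1 : ℝ)) false x : EuclideanSpace ℝ (Fin 3))), (fun x : UnitAddTorus (Fin 3) => (Literature.Analysis.FluidPDE.Torus.stokesMode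 (Pi.single (1 : Fin 3) (1 : ℤ)) (EuclideanSpace.single (0 : Fin 3) (1 : ℝ)) true x + Literature.Analysis.FluidPDE.Torus.stokesMode (Pi.single (2 : Fin 3) (1 : ℤ)) (EuclideanSpace.single (1 : Fin 3) (1 : ℝ)) true x + Literature.Analysis.FluidPDE.Torus.stokesMode (Pi.single (0 : Fin 3) (1 : ℤ)) (EuclideanSpace.single (2 : Fin 3) (1 : ℝ)) true x : EuclideanSpace ℝ (Fin 3))), (fun x : UnitAddTorus (Fin 3) => (Literature.Analysis.FluidPDE.Torus.stokesMode ![(0 : ℤ), 1, 1] (EuclideanSpace.single (0 : Fin 3) (1 : ℝ)) false x + Literature.Analysis.FluidPDE.Torus.stokesMode ![(1 : ℤ), 0, 1] (EuclideanSpace.single (1 : Fin 3) (1 : ℝ)) false x + Literature.Analysis.FluidPDE.Torus.stokesMode ![(1 : ℤ), 1, 0] (EuclideanSpace.single (2 : Fin 3) (1 : ℝ)) false x : EuclideanSpace ℝ (Fin 3)))] → ∀ E : ℝ, 0 < E → ∃ ν₀ m₀ : ℝ, 0 < ν₀ ∧ 0 < m₀ ∧ ∀ c : EuclideanSpace ℝ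 (Fin 3), ‖c‖ = 1 → ∀ ν : ℝ, 0 < ν → ν < ν₀ → ∀ μ : MeasureTheory.Measure (Literature.Analysis.FunctionSpaces.Torus.energySpace (Fin 3)), Literature.Analysis.FluidPDE.Torus.IsStationaryStatisticalSolution ν (fun x : UnitAddTorus (Fin 3) => ∑ i : Fin 3, c i • b i x) μ → MeasureTheory.Integrable (fun u : Literature.Analysis.FunctionSpaces.Torus.energySpace (Fin 3) => ‖u‖ ^ 2) μ → Literature.Analysis.FluidPDE.Torus.ensembleEnergy μ ≤ E → m₀ ^ 2 ≤ ∑ i : Fin 3, (∫ u, Literature.Analysis.FluidPDE.Torus.pairing (u : MeasureTheory.Lp (EuclideanSpace ℝ (Fin 3)) 2 (MeasureTheory.volume : MeasureTheory.Measure (UnitAddTorus (Fin 3)))) (b i) ∂μ) ^ 2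

/-- item stmt-AnomalousDissipation-17145 · crux · rank 3 · open · by planner
why it might fail: some direction of the sphere may be laminar-prone: all its stationary statistics could follow the Stokes scaling ∫|u|²dμ ~ ν⁻² (runaway), as for gravest-mode planar forcing; no ν-uniform energy bound is known for ANY fixed 3-D force.
sources: FMRTTurbulence2001, ConstantinTarfuleaVicol2013, DoeringFoias2002, Literature.Barriers.AnomalousDissipation.Marchioro1986_globalAttraction
[crux] BOUNDED STATISTICS ON THE WHOLE SPHERE. There are E, ν₀ > 0 such that every unit c and every
ν ∈ (0,ν₀) admit a Foias–Prodi stationary statistical solution of NS_ν(f_c) with integrable mean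
energy ≤ E (the energy half of the zeroth law, existential over statistics on the mean-zero space H,
but uniform over the 2-sphere of forces). [difficulty: open-problem] -/
@[route_item "route-AnomalousDissipation-StirringSphere", crux]
def BoundedSphereStatistics : Prop :=
  ∀ b : Fin 3 → UnitAddTorus (Fin 3) → EuclideanSpace ℝ (Fin 3), b = ![(fun x : UnitAddTorus (Fin 3) => (Literature.Analysis.FluidPDE.Torus.stokesMode (Pi.single (2 : Fin 3) (1 : ℤ)) (EuclideanSpace.single (0 : Fin 3) (1 : ℝ)) false x + Literature.Analysis.FluidPDE.Torus.stokesMode (Pi.single (0 : Fin 3) (1 : ℤ)) (EuclideanSpace.single (1 : Fin 3) (1 : ℝ)) false x + Literature.Analysis.FluidPDE.Torus.stokesMode (Pi.single (1 : Fin 3) (1 : ℤ)) (EuclideanSpace.single (2 : Fin 3) (1 : ℝ)) false x : EuclideanSpace ℝ (Fin 3))), (fun x : UnitAddTorus (Fin 3) => (Literature.Analysis.FluidPDE.Torus.stokesMode (Pi.single (1 : Fin 3) (1 : ℤ)) (EuclideanSpace.single (0 : Fin 3) (1 : ℝ)) true x + Literature.Analysis.FluidPDE.Torus.stokesMode (Pi.single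 (2 : Fin 3) (1 : ℤ)) (EuclideanSpace.single (1 : Fin 3) (1 : ℝ)) true x + Literature.Analysis.FluidPDE.Torus.stokesMode (Pi.single (0 : Fin 3) (1 : ℤ)) (EuclideanSpace.single (2 : Fin 3) (1 : ℝ)) true x : EuclideanSpace ℝ (Fin 3))), (fun x : UnitAddTorus (Fin 3) => (Literature.Analysis.FluidPDE.Torus.stokesMode ![(0 : ℤ), 1, 1] (EuclideanSpace.single (0 : Fin 3) (1 : ℝ)) false x + Literature.Analysis.FluidPDE.Torus.stokesMode ![(1 : ℤ), 0, 1] (EuclideanSpace.single (1 : Fin 3) (1 : ℝ)) false x + Literature.Analysis.FluidPDE.Torus.stokesMode ![(1 : ℤ), 1, 0] (EuclideanSpace.single (2 : Fin 3) (1 : ℝ)) false x : EuclideanSpace ℝ (Fin 3)))] → ∃ E ν₀ : ℝ, 0 < E ∧ 0 < ν₀ ∧ ∀ c : EuclideanSpace ℝ (Fin 3), ‖c‖ = 1 → ∀ ν : ℝ, 0 < ν → ν < ν₀ → ∃ μ : MeasureTheory.Measure (Literature.Analysis.FunctionSpaces.Torus.energySpace (Fin 3)), Literature.Analysis.FluidPDE.Torus.IsStationaryStatisticalSolution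 ν (fun x : UnitAddTorus (Fin 3) => ∑ i : Fin 3, c i • b i x) μ ∧ MeasureTheory.Integrable (fun u : Literature.Analysis.FunctionSpaces.Torus.energySpace (Fin 3) => ‖u‖ ^ 2) μ ∧ Literature.Analysis.FluidPDE.Torus.ensembleEnergy μ ≤ E

/-- item stmt-AnomalousDissipation-17146 · crux · rank 4 · open · by planner
why it might fail: the aligned point may wander on S² so that every fixed force is eventually quiet (inviscid statistics need not be upper-hemicontinuous in the force), and ensemble injection ≥ m₀ need not give ensemble DISSIPATION ≥ ε (3-D leakage, FMRT IV (1.31) is an inequality).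
sources: Cheskidov2023, Literature.Barriers.AnomalousDissipation.ForceRobustNoAnomalyNarrow, FMRTTurbulence2001, arXiv:2207.06301
[crux] TRANSFER TO ONE FORCE. If for every small ν some unit c_ν carries a bounded stationary
statistics of NS_ν(f_{c_ν}) with injection ≥ m₀ (AlignedLoudForces), then some fixed unit c*
satisfies EnsembleZerothLawAt (f_{c*}): loudness of a sequence of forces converging INSIDE THE FIXED
3-DIMENSIONAL FAMILY (hence in C^∞) passes to a single force, with ensemble dissipation (not only
injection) bounded below. [deps: NoScreening, BoundedSphereStatistics] [difficulty: open-problem] -/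
@[route_item "route-AnomalousDissipation-StirringSphere", crux]
def SphereTransfer : Prop :=
  ∀ b : Fin 3 → UnitAddTorus (Fin 3) → EuclideanSpace ℝ (Fin 3), b = ![(fun x : UnitAddTorus (Fin 3) => (Literature.Analysis.FluidPDE.Torus.stokesMode (Pi.single (2 : Fin 3) (1 : ℤ)) (EuclideanSpace.single (0 : Fin 3) (1 : ℝ)) false x + Literature.Analysis.FluidPDE.Torus.stokesMode (Pi.single (0 : Fin 3) (1 : ℤ)) (EuclideanSpace.single (1 : Fin 3) (1 : ℝ)) false x + Literature.Analysis.FluidPDE.Torus.stokesMode (Pi.single (1 : Fin 3) (1 : ℤ)) (EuclideanSpace.single (2 : Fin 3) (1 : ℝ)) false x : EuclideanSpace ℝ (Fin 3))), (fun x : UnitAddTorus (Fin 3) => (Literature.Analysis.FluidPDE.Torus.stokesMode (Pi.single (1 : Fin 3) (1 : ℤ)) (EuclideanSpace.single (0 : Fin 3) (1 : ℝ)) true x + Literature.Analysis.FluidPDE.Torus.stokesMode (Pi.single (2 : Fin 3) (1 : ℤ)) (EuclideanSpace.single (1 : Fin 3) (1 : ℝ)) true x + Literature.Analysis.FluidPDE.Torus.stokesMode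 (Pi.single (0 : Fin 3) (1 : ℤ)) (EuclideanSpace.single (2 : Fin 3) (1 : ℝ)) true x : EuclideanSpace ℝ (Fin 3))), (fun x : UnitAddTorus (Fin 3) => (Literature.Analysis.FluidPDE.Torus.stokesMode ![(0 : ℤ), 1, 1] (EuclideanSpace.single (0 : Fin 3) (1 : ℝ)) false x + Literature.Analysis.FluidPDE.Torus.stokesMode ![(1 : ℤ), 0, 1] (EuclideanSpace.single (1 : Fin 3) (1 : ℝ)) false x + Literature.Analysis.FluidPDE.Torus.stokesMode ![(1 : ℤ), 1, 0] (EuclideanSpace.single (2 : Fin 3) (1 : ℝ)) false x : EuclideanSpace ℝ (Fin 3)))] → ∀ E ν₀ m₀ : ℝ, 0 < E → 0 < ν₀ → 0 < m₀ → (∀ ν : ℝ, 0 < ν → ν < ν₀ → ∃ (c : EuclideanSpace ℝ (Fin 3)) (μ : MeasureTheory.Measure (Literature.Analysis.FunctionSpaces.Torus.energySpace (Fin 3))), ‖c‖ = 1 ∧ Literature.Analysis.FluidPDE.Torus.IsStationaryStatisticalSolution ν (fun x : UnitAddTorus (Fin 3) => ∑ i : Fin 3, c i • b i x) μ ∧ MeasureTheory.Integrable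 (fun u : Literature.Analysis.FunctionSpaces.Torus.energySpace (Fin 3) => ‖u‖ ^ 2) μ ∧ Literature.Analysis.FluidPDE.Torus.ensembleEnergy μ ≤ E ∧ m₀ ≤ ∫ u, Literature.Analysis.FluidPDE.Torus.pairing (u : MeasureTheory.Lp (EuclideanSpace ℝ (Fin 3)) 2 (MeasureTheory.volume : MeasureTheory.Measure (UnitAddTorus (Fin 3)))) (fun x : UnitAddTorus (Fin 3) => ∑ i : Fin 3, c i • b i x) ∂μ) → SphereEnsembleZerothLaw

/-- item stmt-AnomalousDissipation-0215 · crux · rank 5 · open · by planner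
why it might fail: a diffuse Foias–Prodi μ in 3-D need not be a marginal of a shift-invariant law on Leray–Hopf paths (VF ⊂ FP; lift proved for time-average measures only, FoiasRosaTemam2019 Thm 5.5); an unshadowed spurious μ breaks it.
sources: FoiasRosaTemam2019, FMRTTurbulence2001, FoiasPadova1972
Sketch: lift μ to a shift-invariant measure on LH trajectories (Vishik–Fursikov; known for
time-average/Galerkin limits, OPEN for general Foias–Prodi μ in 3-D — FoiasRosaTemam2019), Birkhoff
for the two observables, pathwise ε̄ ≤ ‖f‖₂ Ē^{1/2} (from crux Correlation #6), Chebyshev: some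
generic trajectory has ε̄ ≥ ε/2 and Ē ≤ (2‖f‖₂E/ε)² ∨ … ; restart LH at a generic time. If false for
general μ, restate over Torus.IsTimeAverageMeasure. -/
@[route_item "route-AnomalousDissipation-StirringSphere", crux]
def EnsembleRealization : Prop :=
  ∀ f : UnitAddTorus (Fin 3) → EuclideanSpace ℝ (Fin 3), Literature.Analysis.FunctionSpaces.Torus.IsSmooth f → Literature.Analysis.FunctionSpaces.Torus.IsDivFree f → Literature.Analysis.FunctionSpaces.Torus.HasZeroMean f → ∀ (E ε : ℝ), 0 < ε → ∃ M : ℝ, ∀ (ν : ℝ) (μ : MeasureTheory.Measure (Literature.Analysis.FunctionSpaces.Torus.energySpace (Fin 3))), 0 < ν → Literature.Analysis.FluidPDE.Torus.IsStationaryStatisticalSolution ν f μ → MeasureTheory.Integrable (fun u => ‖u‖ ^ 2) μ → Literature.Analysis.FluidPDE.Torus.ensembleEnergy μ ≤ E → ε ≤ Literature.Analysis.FluidPDE.Torus.ensembleDissipation ν μ → ∃ (u₀ : UnitAddTorus (Fin 3) → EuclideanSpace ℝ (Fin 3)) (u : ℝ → UnitAddTorus (Fin 3) → EuclideanSpace ℝ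 (Fin 3)), Literature.Analysis.FluidPDE.Torus.IsGlobalLerayHopf ν (fun _ => f) u₀ u ∧ Literature.Analysis.FluidPDE.meanEnergy u ≤ M ∧ ε / 2 ≤ Literature.Analysis.FluidPDE.meanDissipation ν u

-- earlier HairyBallAlignment (stmt-AnomalousDissipation-17148, replaced 2026-08-16T22:40:03Z -> stmt-AnomalousDissipation-17155): retired by None — NoScreening → BoundedSphereStatistics → AlignedLoudForces
/-- item stmt-AnomalousDissipation-17155 · crux · rank 9 · open · by planner
why it might fail: the Foias-Prodi class (ALL shell energy inequalities + integrability side conditions) may fail to be weakly closed at fixed nu, or the bounded sets may lack u.h.c. in c; then the set-valued hairy-ball step needs a modified class and AlignedLoudForces must be restated over it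
sources: Milnor1978, doi:10.1007/bf02410784, FMRTTurbulence2001, Literature.Topology.Euclidean.HairyBall.exists_eq_zero_of_tangent
THE TOPOLOGICAL STEP (provable): NoScreening → BoundedSphereStatistics → (aligned loud forces on the
sphere at every small ν, with the SAME explicit family) — conclusion written out in full (formerly
the support node AlignedLoudForces), so that the decl is self-contained for the crux-only deciding
theorem -/
@[route_item "route-AnomalousDissipation-StirringSphere", crux]
def HairyBallAlignment : Prop :=
  NoScreening → BoundedSphereStatistics → ∀ b : Fin 3 → UnitAddTorus (Fin 3) → EuclideanSpace ℝ (Fin 3), b = ![(fun x : UnitAddTorus (Fin 3) => (Literature.Analysis.FluidPDE.Torus.stokesMode (Pi.single (2 : Fin 3) (1 : ℤ)) (EuclideanSpace.single (0 : Fin 3) (1 : ℝ)) false x + Literature.Analysis.FluidPDE.Torus.stokesMode (Pi.single (0 : Fin 3) (1 : ℤ)) (EuclideanSpace.single (1 : Fin 3) (1 : ℝ)) false x + Literature.Analysis.FluidPDE.Torus.stokesMode (Pi.single (1 : Fin 3) (1 : ℤ)) (EuclideanSpace.single (2 : Fin 3) (1 : ℝ)) false x : EuclideanSpace ℝ (Fin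 3))), (fun x : UnitAddTorus (Fin 3) => (Literature.Analysis.FluidPDE.Torus.stokesMode (Pi.single (1 : Fin 3) (1 : ℤ)) (EuclideanSpace.single (0 : Fin 3) (1 : ℝ)) true x + Literature.Analysis.FluidPDE.Torus.stokesMode (Pi.single (2 : Fin 3) (1 : ℤ)) (EuclideanSpace.single (1 : Fin 3) (1 : ℝ)) true x + Literature.Analysis.FluidPDE.Torus.stokesMode (Pi.single (0 : Fin 3) (1 : ℤ)) (EuclideanSpace.single (2 : Fin 3) (1 : ℝ)) true x : EuclideanSpace ℝ (Fin 3))), (fun x : UnitAddTorus (Fin 3) => (Literature.Analysis.FluidPDE.Torus.stokesMode ![(0 : ℤ), 1, 1] (EuclideanSpace.single (0 : Fin 3) (1 : ℝ)) false x + Literature.Analysis.FluidPDE.Torus.stokesMode ![(1 : ℤ), 0, 1] (EuclideanSpace.single (1 : Fin 3) (1 : ℝ)) false x + Literature.Analysis.FluidPDE.Torus.stokesMode ![(1 : ℤ), 1, 0] (EuclideanSpace.single (2 : Fin 3) (1 : ℝ)) false x : EuclideanSpace ℝ (Fin 3)))] → ∃ E ν₀ m₀ : ℝ, 0 < E ∧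 0 < ν₀ ∧ 0 < m₀ ∧ ∀ ν : ℝ, 0 < ν → ν < ν₀ → ∃ (c : EuclideanSpace ℝ (Fin 3)) (μ : MeasureTheory.Measure (Literature.Analysis.FunctionSpaces.Torus.energySpace (Fin 3))), ‖c‖ = 1 ∧ Literature.Analysis.FluidPDE.Torus.IsStationaryStatisticalSolution ν (fun x : UnitAddTorus (Fin 3) => ∑ i : Fin 3, c i • b i x) μ ∧ MeasureTheory.Integrable (fun u : Literature.Analysis.FunctionSpaces.Torus.energySpace (Fin 3) => ‖u‖ ^ 2) μ ∧ Literature.Analysis.FluidPDE.Torus.ensembleEnergy μ ≤ E ∧ m₀ ≤ ∫ u, Literature.Analysis.FluidPDE.Torus.pairing (u : MeasureTheory.Lp (EuclideanSpace ℝ (Fin 3)) 2 (MeasureTheory.volume : MeasureTheory.Measure (UnitAddTorus (Fin 3)))) (fun x : UnitAddTorus (Fin 3) => ∑ i : Fin 3, c i • b i x) ∂μ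

/-- item stmt-AnomalousDissipation-17149 · support · rank 9 · open · by planner
sources: Literature.Analysis.FluidPDE.Torus.isSmooth_stokesMode, Literature.Analysis.FluidPDE.Torus.isDivFree_stokesMode, Literature.Analysis.FluidPDE.Torus.hasZeroMean_stokesMode
[support] every f_c = Σ c_i b_i is smooth, divergence-free and mean-zero (finite sums of Stokes
modes with k ≠ 0 and k·a = 0: isSmooth_stokesMode, isDivFree_stokesMode, hasZeroMean_stokesMode,
closure under + and scalar •). [difficulty: provable-now] -/
@[route_item "route-AnomalousDissipation-StirringSphere"]
def SphereForcesAdmissible : Prop :=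
  ∀ b : Fin 3 → UnitAddTorus (Fin 3) → EuclideanSpace ℝ (Fin 3), b = ![(fun x : UnitAddTorus (Fin 3) => (Literature.Analysis.FluidPDE.Torus.stokesMode (Pi.single (2 : Fin 3) (1 : ℤ)) (EuclideanSpace.single (0 : Fin 3) (1 : ℝ)) false x + Literature.Analysis.FluidPDE.Torus.stokesMode (Pi.single (0 : Fin 3) (1 : ℤ)) (EuclideanSpace.single (1 : Fin 3) (1 : ℝ)) false x + Literature.Analysis.FluidPDE.Torus.stokesMode (Pi.single (1 : Fin 3) (1 : ℤ)) (EuclideanSpace.single (2 : Fin 3) (1 : ℝ)) false x : EuclideanSpace ℝ (Fin 3))), (fun x : UnitAddTorus (Fin 3) => (Literature.Analysis.FluidPDE.Torus.stokesMode (Pi.single (1 : Fin 3) (1 : ℤ)) (EuclideanSpace.single (0 : Fin 3) (1 : ℝ)) true x + Literature.Analysis.FluidPDE.Torus.stokesMode (Pi.single (2 : Fin 3) (1 : ℤ)) (EuclideanSpace.single (1 : Fin 3) (1 : ℝ)) true x + Literature.Analysis.FluidPDE.Torus.stokesMode (Pi.single (0 : Fin 3) (1 : ℤ)) (EuclideanSpace.single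 (2 : Fin 3) (1 : ℝ)) true x : EuclideanSpace ℝ (Fin 3))), (fun x : UnitAddTorus (Fin 3) => (Literature.Analysis.FluidPDE.Torus.stokesMode ![(0 : ℤ), 1, 1] (EuclideanSpace.single (0 : Fin 3) (1 : ℝ)) false x + Literature.Analysis.FluidPDE.Torus.stokesMode ![(1 : ℤ), 0, 1] (EuclideanSpace.single (1 : Fin 3) (1 : ℝ)) false x + Literature.Analysis.FluidPDE.Torus.stokesMode ![(1 : ℤ), 1, 0] (EuclideanSpace.single (2 : Fin 3) (1 : ℝ)) false x : EuclideanSpace ℝ (Fin 3)))] → ∀ c : EuclideanSpace ℝ (Fin 3), Literature.Analysis.FunctionSpaces.Torus.IsSmooth (fun x : UnitAddTorus (Fin 3) => ∑ i : Fin 3, c i • b i x) ∧ Literature.Analysis.FunctionSpaces.Torus.IsDivFree (fun x : UnitAddTorus (Fin 3) => ∑ i : Fin 3, c i • b i x) ∧ Literature.Analysis.FunctionSpaces.Torus.HasZeroMean (fun x : UnitAddTorus (Fin 3) => ∑ i : Fin 3, c i • b i x)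

/-- item stmt-AnomalousDissipation-17150 · assembly · rank 1 · open · by planner
sources: FMRTTurbulence2001, Milnor1978
[assembly] NoScreening → BoundedSphereStatistics → HairyBallAlignment → SphereTransfer →
EnsembleRealization → SphereForcesAdmissible → AnomalousDissipation. -/
@[route_item "route-AnomalousDissipation-StirringSphere"]
def Assembly : Prop :=
  NoScreening → BoundedSphereStatistics → HairyBallAlignment → SphereTransfer → EnsembleRealization → SphereForcesAdmissible → AnomalousDissipation

/-! D-0027 §2.1 — DECIDING THEOREM (planner-authored via `route open/edit --closes-file`; by planner-rrepair-AnomalousDissipation-StirringS-6d60ce93-0 2026-08-16T22:55:00Z):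
its hypotheses are this route's items and its conclusion the sub-problem Statement (glue_lint), and it elaborates with this file. -/

@[closes "route-AnomalousDissipation-StirringSphere"] theorem closes : NoScreening → BoundedSphereStatistics → HairyBallAlignment → SphereTransfer → EnsembleRealization → _root_.AnomalousDissipation := by
  intro hNS hB hHB hT hR
  -- (1) the cruxes: hairy-ball alignment, transfer to one force of the sphere
  obtain ⟨E, ν₀, m₀, hE, hν₀, hm₀, hal⟩ := hHB hNS hB _ rfl
  have hX : SphereEnsembleZerothLaw := hT _ rfl E ν₀ m₀ hE hν₀ hm₀ hal
  obtain ⟨c, hc, hEZ⟩ := hX _ rfl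
  -- (2) admissibility of every force of the sphere (support `SphereForcesAdmissible`, proved inline:
  --     finite sums of scalar multiples of transversal Stokes modes are smooth, solenoidal, mean zero)
  have inner_latticeVec_single : ∀ (k : Fin 3 → ℤ) (i : Fin 3),
      inner ℝ (Literature.Analysis.FunctionSpaces.Torus.latticeVec k) (EuclideanSpace.single i (1 : ℝ)) = (k i : ℝ) := by
    intro k i
    rw [EuclideanSpace.inner_single_right, Literature.Analysis.FunctionSpaces.Torus.latticeVec_apply]; simp
  have mode_admissible : ∀ (k : Fin 3 → ℤ) (i : Fin 3), k i = 0 → k ≠ 0 → ∀ cb : Bool,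
      Literature.Analysis.FunctionSpaces.Torus.IsSmooth ⇑(Literature.Analysis.FluidPDE.Torus.stokesMode k (EuclideanSpace.single i (1 : ℝ)) cb) ∧
        Literature.Analysis.FunctionSpaces.Torus.IsDivFree ⇑(Literature.Analysis.FluidPDE.Torus.stokesMode k (EuclideanSpace.single i (1 : ℝ)) cb) ∧
        Literature.Analysis.FunctionSpaces.Torus.HasZeroMean ⇑(Literature.Analysis.FluidPDE.Torus.stokesMode k (EuclideanSpace.single i (1 : ℝ)) cb) := by
    intro k i hki hk cb
    refine ⟨Literature.Analysis.FluidPDE.Torus.isSmooth_stokesMode _ _ _,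
      Literature.Analysis.FluidPDE.Torus.isDivFree_stokesMode ?_ _,
      Literature.Analysis.FluidPDE.Torus.hasZeroMean_stokesMode hk _ _⟩
    rw [inner_latticeVec_single, hki]; simp
  have add3_admissible : ∀ {u v w : UnitAddTorus (Fin 3) → EuclideanSpace ℝ (Fin 3)},
      (Literature.Analysis.FunctionSpaces.Torus.IsSmooth u ∧ Literature.Analysis.FunctionSpaces.Torus.IsDivFree u ∧ Literature.Analysis.FunctionSpaces.Torus.HasZeroMean u) →
      (Literature.Analysis.FunctionSpaces.Torus.IsSmooth v ∧ Literature.Analysis.FunctionSpaces.Torus.IsDivFree v ∧ Literature.Analysis.FunctionSpaces.Torus.HasZeroMean v) →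
      (Literature.Analysis.FunctionSpaces.Torus.IsSmooth w ∧ Literature.Analysis.FunctionSpaces.Torus.IsDivFree w ∧ Literature.Analysis.FunctionSpaces.Torus.HasZeroMean w) →
      Literature.Analysis.FunctionSpaces.Torus.IsSmooth (fun x => u x + v x + w x) ∧
        Literature.Analysis.FunctionSpaces.Torus.IsDivFree (fun x => u x + v x + w x) ∧
        Literature.Analysis.FunctionSpaces.Torus.HasZeroMean (fun x => u x + v x + w x) := by
    intro u v w hu hv hw
    have huv : Literature.Analysis.FunctionSpaces.Torus.IsSmooth (fun x => u x + v x) := hu.1.add hv.1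
    exact ⟨huv.add hw.1,
      Summit.AnomalousDissipation.AnomalousDissipation.Theorems.SteadyStatesLoudBounded.GpAdmissible.isDivFree_add huv hw.1
        (Summit.AnomalousDissipation.AnomalousDissipation.Theorems.SteadyStatesLoudBounded.GpAdmissible.isDivFree_add hu.1 hv.1 hu.2.1 hv.2.1) hw.2.1,
      Summit.AnomalousDissipation.AnomalousDissipation.Theorems.SteadyStatesLoudBounded.GpAdmissible.hasZeroMean_add huv hw.1
        (Summit.AnomalousDissipation.AnomalousDissipation.Theorems.SteadyStatesLoudBounded.GpAdmissible.hasZeroMean_add hu.1 hv.1 hu.2.2 hv.2.2) hw.2.2⟩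
  -- homogeneity of divergence-freeness and of the zero-mean property, from the torus calculus of the
  -- Statement's own closure (Torus.divergence_eq_trace_fderiv, Torus.fderiv_const_smul, integral_smul):
  -- no import beyond StokesTorus(Proofs) / StatisticalSolution / the landed GpAdmissible lemmas is needed
  have divergence_const_smul : ∀ {u : UnitAddTorus (Fin 3) → EuclideanSpace ℝ (Fin 3)}
      (hu : Literature.Analysis.FunctionSpaces.Torus.IsContDiff 1 u) (a : ℝ) (x : UnitAddTorus (Fin 3)),
      Literature.Analysis.FunctionSpaces.Torus.divergence (fun y => a • u y) x =
        a * Literature.Analysis.FunctionSpaces.Torus.divergence u x := by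
    intro u hu a x
    rw [show (fun y => a • u y) = a • u from rfl,
      Literature.Analysis.FunctionSpaces.Torus.divergence_eq_trace_fderiv (hu.smul a),
      Literature.Analysis.FunctionSpaces.Torus.divergence_eq_trace_fderiv hu,
      Literature.Analysis.FunctionSpaces.Torus.fderiv_const_smul hu a, ContinuousLinearMap.toLinearMap_smul,
      map_smul, smul_eq_mul]
  have smul_admissible : ∀ {u : UnitAddTorus (Fin 3) → EuclideanSpace ℝ (Fin 3)} (a : ℝ),
      (Literature.Analysis.FunctionSpaces.Torus.IsSmooth u ∧ Literature.Analysis.FunctionSpaces.Torus.IsDivFree u ∧ Literature.Analysis.FunctionSpaces.Torus.HasZeroMean u) →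
      Literature.Analysis.FunctionSpaces.Torus.IsSmooth (fun x => a • u x) ∧
        Literature.Analysis.FunctionSpaces.Torus.IsDivFree (fun x => a • u x) ∧
        Literature.Analysis.FunctionSpaces.Torus.HasZeroMean (fun x => a • u x) := by
    intro u a hu
    refine ⟨hu.1.smul a, fun x => ?_, ?_⟩
    · rw [divergence_const_smul (hu.1.isContDiff (by simp)) a x, hu.2.1 x, mul_zero]
    · have h0 : ∫ x, u x = 0 := hu.2.2
      show ∫ x, a • u x = 0
      rw [integral_smul, h0, smul_zero]
  have sum_admissible : ∀ (b : Fin 3 → UnitAddTorus (Fin 3) → EuclideanSpace ℝ (Fin 3)),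
      (∀ i, Literature.Analysis.FunctionSpaces.Torus.IsSmooth (b i) ∧ Literature.Analysis.FunctionSpaces.Torus.IsDivFree (b i) ∧ Literature.Analysis.FunctionSpaces.Torus.HasZeroMean (b i)) →
      ∀ c : EuclideanSpace ℝ (Fin 3),
      Literature.Analysis.FunctionSpaces.Torus.IsSmooth (fun x => ∑ i : Fin 3, c i • b i x) ∧
        Literature.Analysis.FunctionSpaces.Torus.IsDivFree (fun x => ∑ i : Fin 3, c i • b i x) ∧
        Literature.Analysis.FunctionSpaces.Torus.HasZeroMean (fun x => ∑ i : Fin 3, c i • b i x) := by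
    intro b hb c
    have h : (fun x => ∑ i : Fin 3, c i • b i x) = fun x => c 0 • b 0 x + c 1 • b 1 x + c 2 • b 2 x := by
      funext x; rw [Fin.sum_univ_three]
    rw [h]
    exact add3_admissible (smul_admissible (c 0) (hb 0)) (smul_admissible (c 1) (hb 1)) (smul_admissible (c 2) (hb 2))
  have hA : SphereForcesAdmissible := by
    rintro b rfl c'
    refine sum_admissible _ ?_ c'
    have hne : ∀ j : Fin 3, (Pi.single j (1 : ℤ) : Fin 3 → ℤ) ≠ 0 := by
      intro j h; have := congr_fun h j; simp at this
    have hk2a : (![(0 : ℤ), 1, 1] : Fin 3 → ℤ) ≠ 0 := by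
      intro h; have := congr_fun h 1; simp at this
    have hk2b : (![(1 : ℤ), 0, 1] : Fin 3 → ℤ) ≠ 0 := by
      intro h; have := congr_fun h 0; simp at this
    have hk2c : (![(1 : ℤ), 1, 0] : Fin 3 → ℤ) ≠ 0 := by
      intro h; have := congr_fun h 0; simp at this
    intro i
    fin_cases i
    · exact add3_admissible
        (mode_admissible (Pi.single (2 : Fin 3) (1 : ℤ)) 0 (by simp) (hne 2) false)
        (mode_admissible (Pi.single (0 : Fin 3) (1 : ℤ)) 1 (by simp) (hne 0) false)
        (mode_admissible (Pi.single (1 : Fin 3) (1 : ℤ)) 2 (by simp) (hne 1) false)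
    · exact add3_admissible
        (mode_admissible (Pi.single (1 : Fin 3) (1 : ℤ)) 0 (by simp) (hne 1) true)
        (mode_admissible (Pi.single (2 : Fin 3) (1 : ℤ)) 1 (by simp) (hne 2) true)
        (mode_admissible (Pi.single (0 : Fin 3) (1 : ℤ)) 2 (by simp) (hne 0) true)
    · exact add3_admissible
        (mode_admissible ![(0 : ℤ), 1, 1] 0 (by simp) hk2a false)
        (mode_admissible ![(1 : ℤ), 0, 1] 1 (by simp) hk2b false)
        (mode_admissible ![(1 : ℤ), 1, 0] 2 (by simp) hk2c false)
  obtain ⟨hs, hd, hz⟩ := hA _ rfl c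
  -- (3) realisation: the shared crux of route Ensemble, verbatim its deciding term
  rcases hEZ with ⟨ν, μ, hν, hν0, hstat, hint, ⟨E', hE'⟩, ε, hε, hεμ⟩
  obtain ⟨M, hM⟩ := hR _ hs hd hz E' ε hε
  choose u₀ u hu using fun j => hM (ν j) (μ j) (hν j) (hstat j) (hint j) (hE' j) (hεμ j)
  unfold _root_.AnomalousDissipation Literature.Turb.ZerothLaw
  exact ⟨_, hs, hd, hz, ν, u₀, u, hν, hν0, fun j => (hu j).1, ⟨M, fun j => (hu j).2.1⟩,
    ε / 2, half_pos hε, fun j => (hu j).2.2⟩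

end Summit.AnomalousDissipation.AnomalousDissipation.Theses.StirringSphere
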